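import Literature.Computability.AlgebraicComplexity.SupportRankWeightRemoval
import Literature.Computability.AlgebraicComplexity.SupportRankProofs
import Literature.Computability.AlgebraicComplexity.CoppersmithWinograd1990Proofs
import Literature.Computability.AlgebraicComplexity.KroneckerRank
import Literature.Computability.AlgebraicComplexity.MatMulMonomialSubrank
import Literature.Computability.AlgebraicComplexity.TensorMultiples
import Literature.Computability.AlgebraicComplexity.TensorRankFactsProofs

/-!
# The s-rank asymptotic sum inequality (cube case), by slot symmetrisation

Solo deliverable (informed mode). Cohn–Umans 2013 (§5, eq. (s-rank-asi)) state that "one can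
imitate the proof of the asymptotic sum inequality" for the SUPPORT RANK `R_s` (Def. 1: the least
rank of a tensor with the same support). The imitation is not literal: the merging step
`⟨a⟩ ⊗ W ≤ ⟨g⟩ ⊗ W` (`R(⟨a,a,a⟩) ≤ g`) of Schönhage's proof needs the `g` slots to carry the SAME
tensor, while a same-support version `D` of `⟨P⟩ ⊗ W` carries `P` differently weighted copies
`W₁, …, W_P` of `W`. Repair (**slot symmetrisation**, `exists_equal_slots`): in `D^{⊠t}` the
slots indexed by the words `J ∈ [P]^t` with the same letter counts carry ISOMORPHIC tensors (a
permutation of the `t` factors), and the largest class has `g ≥ P^t/(t+1)^P` words; so some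
same-support version `W_t` of `W^{⊠t}` has `R(⟨g⟩ ⊗ W_t) ≤ R(D)^t` with EQUAL slots. Merging then
works, and `t → ∞` gives the **s-rank asymptotic sum inequality for cubes**:
`P · Q^{ω_s} ≤ R(D)` for every `D` with the support of `⟨P⟩ ⊗ ⟨Q,Q,Q⟩`, i.e.
`P · Q^{ω_s} ≤ R_s(⟨P⟩ ⊗ ⟨Q,Q,Q⟩)` (`mul_rpow_omegaS_le_tensorRank`) — the engine of the s-rank
laser door. Also: `ω_s` is an exponent (`exists_supportRank_matMulTensor_le_rpow`).

[cite: CohnUmans2013, §5 eq. (s-rank-asi) and Prop. 5] [cite: Blaser2013, Thm. 7.4 and Lemma 7.7]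
-/

noncomputable section

open scoped BigOperators
open Filter Asymptotics Finset

namespace Summit.MatrixMultiplication.MatrixMultiplication.Theorems.SupportRankDoor

open Literature.Computability.AlgebraicComplexity

universe u

variable {K : Type u} [Field K]

/-! ## `ω_s` is an exponent -/

/-- **`ω_s` is an exponent**: for every `δ > 0` there is `C > 0` with
`R_s(⟨a,a,a⟩) ≤ C · a^{ω_s + δ}` for all `a ≥ 1` (`ω_s` is the infimum of the s-admissible
exponents, so some s-admissible `β < ω_s + δ` exists).
[cite: CohnUmans2013, §3 (definition of ω_s)] -/
theorem exists_supportRank_matMulTensor_le_rpow (K : Type u) [Field K] {δ : ℝ} (hδ : 0 < δ) :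
    ∃ C : ℝ, 0 < C ∧ ∀ a : ℕ, 1 ≤ a →
      (supportRank (matMulTensor K a a a) : ℝ) ≤ C * (a : ℝ) ^ (omegaS K + δ) := by
  have hlt : sInf (sAdmissibleExponents K) < omegaS K + δ := by
    show omegaS K < omegaS K + δ; linarith
  obtain ⟨β, hβ, hβlt⟩ := exists_lt_of_csInf_lt (sAdmissibleExponents_nonempty K) hlt
  obtain ⟨C, hC, hb⟩ := bound_of_isBigO_nat_atTop hβ
  refine ⟨C, hC, fun a ha => ?_⟩
  have ha0 : (0 : ℝ) < a := by exact_mod_cast ha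
  have hg : (a : ℝ) ^ β ≠ 0 := (Real.rpow_pos_of_pos ha0 _).ne'
  have h := hb hg
  rw [Real.norm_of_nonneg (Nat.cast_nonneg _), Real.norm_of_nonneg (Real.rpow_nonneg ha0.le _)] at h
  refine h.trans (mul_le_mul_of_nonneg_left ?_ hC.le)
  exact Real.rpow_le_rpow_of_exponent_le (by exact_mod_cast ha) hβlt.le

/-! ## Slot symmetrisation -/

section Slots

variable {X Y Z : Type}

/-- The slots of a same-support version `D` of `⟨P⟩ ⊗ W` are same-support versions of `W`.
[cite: CohnUmans2013, Def. 1] -/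
theorem sameSupport_slot {P : ℕ} (W : X → Y → Z → K)
    (D : Fin P × X → Fin P × Y → Fin P × Z → K)
    (hD : SameSupport (kroneckerTensor (unitTensor K P) W) D) (j : Fin P) :
    SameSupport W (fun x y z => D (j, x) (j, y) (j, z)) := by
  intro x y z
  have h := hD (j, x) (j, y) (j, z)
  simp only [kroneckerTensor_apply, unitTensor_apply, and_self, if_true, one_mul] at h
  exact h

/-- Off the slot diagonal a same-support version `D` of `⟨P⟩ ⊗ W` vanishes.
[cite: CohnUmans2013, Def. 1] -/
theorem slot_offDiag {P : ℕ} (W : X → Y → Z → K)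
    (D : Fin P × X → Fin P × Y → Fin P × Z → K)
    (hD : SameSupport (kroneckerTensor (unitTensor K P) W) D) {j j' j'' : Fin P}
    (hj : ¬ (j = j' ∧ j' = j'')) (x : X) (y : Y) (z : Z) : D (j, x) (j', y) (j'', z) = 0 := by
  have h := hD (j, x) (j', y) (j'', z)
  simp only [kroneckerTensor_apply, unitTensor_apply, if_neg hj, zero_mul, ne_eq,
    not_true_eq_false, false_iff, not_not] at h
  exact h

variable [Fintype X] [Fintype Y] [Fintype Z]

/-- Two words `J, J₀ : Fin t → Fin P` with the same letter counts differ by a permutation of the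
positions (glue fibrewise bijections along `Equiv.sigmaFiberEquiv`). [folklore] -/
theorem exists_perm_of_card_fiber_eq {t P : ℕ} (J J₀ : Fin t → Fin P)
    (h : ∀ b : Fin P,
      (univ.filter fun i => J i = b).card = (univ.filter fun i => J₀ i = b).card) :
    ∃ σ : Equiv.Perm (Fin t), ∀ k, J (σ k) = J₀ k := by
  classical
  have hc : ∀ b : Fin P, Fintype.card {i // J₀ i = b} = Fintype.card {i // J i = b} :=
    fun b => by rw [Fintype.card_subtype, Fintype.card_subtype, h b]
  let e : ∀ b : Fin P, {i // J₀ i = b} ≃ {i // J i = b} :=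
    fun b => Fintype.equivOfCardEq (hc b)
  refine ⟨(Equiv.sigmaFiberEquiv J₀).symm.trans
    ((Equiv.sigmaCongrRight e).trans (Equiv.sigmaFiberEquiv J)), fun k => ?_⟩
  exact (e (J₀ k) ⟨k, rfl⟩).2

/-- **Slot symmetrisation.** If `D` has the support of `⟨P⟩ ⊗ W` (`P ≥ 1`), then for every `t`
there are `g ≥ 1` with `P^t ≤ (t+1)^P · g` and `W_t` with the support of `W^{⊠t}` such that
`R(⟨g⟩ ⊗ W_t) ≤ R(D)^t` — the SAME `W_t` in all `g` slots (`W_t` = the slot of `D^{⊠t}` at a word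
`J₀ ∈ [P]^t` of a largest letter-count class; the `g` words of the class give slots isomorphic to
it by permuting factors; at most `(t+1)^P` classes). [cite: CohnUmans2013, §5 eq. (s-rank-asi)] -/
theorem exists_equal_slots {P : ℕ} (hP : 1 ≤ P) (W : X → Y → Z → K)
    (D : Fin P × X → Fin P × Y → Fin P × Z → K)
    (hD : SameSupport (kroneckerTensor (unitTensor K P) W) D) (t : ℕ) :
    ∃ g : ℕ, 1 ≤ g ∧ P ^ t ≤ (t + 1) ^ P * g ∧
      ∃ Wt : (Fin t → X) → (Fin t → Y) → (Fin t → Z) → K,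
        SameSupport (kroneckerPow W t) Wt ∧
        tensorRank (kroneckerTensor (unitTensor K g) Wt) ≤ tensorRank D ^ t := by
  classical
  -- letter counts of a word
  let τ : (Fin t → Fin P) → (Fin P → Fin (t + 1)) := fun J b =>
    ⟨(univ.filter fun i => J i = b).card,
      Nat.lt_succ_of_le ((card_le_card (filter_subset _ _)).trans (by simp))⟩
  let fib : (Fin t → Fin P) → ℕ := fun J => (univ.filter fun J' => τ J' = τ J).card
  haveI : Nonempty (Fin P) := ⟨⟨0, hP⟩⟩
  obtain ⟨J₀, -, hJ₀⟩ := exists_max_image (univ : Finset (Fin t → Fin P)) fib univ_nonempty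
  -- the class of `J₀`: words that are permutations of it
  let C : Finset (Fin t → Fin P) :=
    univ.filter fun J => ∃ σ : Equiv.Perm (Fin t), ∀ k, J (σ k) = J₀ k
  have hfibC : (univ.filter fun J' => τ J' = τ J₀) ⊆ C := by
    intro J hJ
    simp only [C, mem_filter, mem_univ, true_and] at hJ ⊢
    exact exists_perm_of_card_fiber_eq J J₀ fun b => Fin.ext_iff.1 (congrFun hJ b)
  have hJ₀C : J₀ ∈ C := mem_filter.2 ⟨mem_univ _, Equiv.refl _, fun k => rfl⟩
  have hg1 : 1 ≤ C.card := card_pos.2 ⟨J₀, hJ₀C⟩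
  have hcount : P ^ t ≤ (t + 1) ^ P * C.card := by
    have h2 : ∀ y ∈ univ.image τ, (univ.filter fun J' => τ J' = y).card ≤ C.card := by
      intro y hy
      obtain ⟨J, -, rfl⟩ := mem_image.1 hy
      exact (hJ₀ J (mem_univ _)).trans (card_le_card hfibC)
    have h3 : (univ.image τ).card ≤ (t + 1) ^ P := (card_le_univ _).trans (by simp)
    calc P ^ t = (univ : Finset (Fin t → Fin P)).card := by simp
      _ = ∑ y ∈ univ.image τ, (univ.filter fun J' => τ J' = y).card :=
          card_eq_sum_card_image τ univ
      _ ≤ ∑ y ∈ univ.image τ, C.card := sum_le_sum h2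
      _ = (univ.image τ).card * C.card := by rw [sum_const, smul_eq_mul]
      _ ≤ (t + 1) ^ P * C.card := Nat.mul_le_mul_right _ h3
  -- enumerate the class and choose the permutations
  let Jc : Fin C.card → (Fin t → Fin P) := fun c => (C.equivFin.symm c).1
  have hJc_inj : Function.Injective Jc := Subtype.val_injective.comp C.equivFin.symm.injective
  have hJc_perm : ∀ c, ∃ σ : Equiv.Perm (Fin t), ∀ k, Jc c (σ k) = J₀ k := fun c =>
    (mem_filter.1 (C.equivFin.symm c).2).2
  choose σ hσ using hJc_perm
  -- the common slot and the index maps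
  let Wt : (Fin t → X) → (Fin t → Y) → (Fin t → Z) → K :=
    fun x y z => ∏ k, D (J₀ k, x k) (J₀ k, y k) (J₀ k, z k)
  let F : Fin C.card × (Fin t → X) → (Fin t → Fin P × X) :=
    fun cx i => (Jc cx.1 i, cx.2 ((σ cx.1).symm i))
  let G : Fin C.card × (Fin t → Y) → (Fin t → Fin P × Y) :=
    fun cy i => (Jc cy.1 i, cy.2 ((σ cy.1).symm i))
  let H : Fin C.card × (Fin t → Z) → (Fin t → Fin P × Z) :=
    fun cz i => (Jc cz.1 i, cz.2 ((σ cz.1).symm i))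
  have key : kroneckerTensor (unitTensor K C.card) Wt =
      fun a b c => kroneckerPow D t (F a) (G b) (H c) := by
    funext ⟨ca, x⟩ ⟨cb, y⟩ ⟨cc, z⟩
    simp only [kroneckerTensor_apply, unitTensor_apply, kroneckerPow_apply, Wt, F, G, H]
    by_cases h : ca = cb ∧ cb = cc
    · obtain ⟨rfl, rfl⟩ := h
      rw [if_pos ⟨rfl, rfl⟩, one_mul,
        ← Equiv.prod_comp (σ ca) (fun i => D (Jc ca i, x ((σ ca).symm i))
          (Jc ca i, y ((σ ca).symm i)) (Jc ca i, z ((σ ca).symm i)))]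
      simp only [Equiv.symm_apply_apply, hσ]
    · rw [if_neg h, zero_mul]
      have hex : ∃ i, ¬ (Jc ca i = Jc cb i ∧ Jc cb i = Jc cc i) := by
        by_contra hall
        push Not at hall
        exact h ⟨hJc_inj (funext fun i => (hall i).1), hJc_inj (funext fun i => (hall i).2)⟩
      obtain ⟨i, hi⟩ := hex
      exact (prod_eq_zero (mem_univ i) (slot_offDiag W D hD hi _ _ _)).symm
  refine ⟨C.card, hg1, hcount, Wt, ?_, ?_⟩
  · intro x y z
    simp only [kroneckerPow_apply, Wt, prod_ne_zero_iff]
    exact forall₂_congr fun k _ => sameSupport_slot W D hD (J₀ k) (x k) (y k) (z k)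
  · rw [key]
    exact (tensorRank_precomp_le _ F G H).trans (tensorRank_kroneckerPow_le D t)

end Slots

/-! ## The s-rank asymptotic sum inequality for cubes -/

/-- One symmetrised level of the s-rank ASI: for `D` with the support of `⟨P⟩ ⊗ ⟨Q,Q,Q⟩` and
every `t`: `g ≥ 1`, `P^t ≤ (t+1)^P g`, `a ≥ 1` with `(g/C_δ)^{1/(ω_s+δ)} < a + 1` and
`(a Q^t)^{ω_s} ≤ R(D)^t` (equal slots `⟨g⟩ ⊗ W_t`; a least-rank same-support `V ∼ ⟨a,a,a⟩` has
`R(V) = R_s(⟨a⟩) ≤ g`; `V ⊗ W_t ∼ ⟨aQ^t⟩`, Prop. 5). [cite: CohnUmans2013, Prop. 5] -/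
theorem supportSum_level {P Q : ℕ} (hP : 1 ≤ P) (hQ : 2 ≤ Q)
    (D : Fin P × (Fin Q × Fin Q) → Fin P × (Fin Q × Fin Q) → Fin P × (Fin Q × Fin Q) → K)
    (hD : SameSupport (kroneckerTensor (unitTensor K P) (matMulTensor K Q Q Q)) D)
    {δ Cδ : ℝ} (hCδ : 0 < Cδ)
    (hCδb : ∀ a : ℕ, 1 ≤ a →
      (supportRank (matMulTensor K a a a) : ℝ) ≤ Cδ * (a : ℝ) ^ (omegaS K + δ))
    (hωδ : 0 < omegaS K + δ) (t : ℕ) :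
    ∃ g : ℕ, 1 ≤ g ∧ P ^ t ≤ (t + 1) ^ P * g ∧ ∃ a : ℕ, 1 ≤ a ∧
      ((g : ℝ) / Cδ) ^ (omegaS K + δ)⁻¹ < a + 1 ∧
      ((a : ℝ) * (Q : ℝ) ^ t) ^ omegaS K ≤ (tensorRank D : ℝ) ^ t := by
  classical
  obtain ⟨g, hg1, hcount, Wt, hWt, hrank⟩ := exists_equal_slots hP (matMulTensor K Q Q Q) D hD t
  refine ⟨g, hg1, hcount, ?_⟩
  set Xr : ℝ := ((g : ℝ) / Cδ) ^ (omegaS K + δ)⁻¹ with hXr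
  have hXr0 : 0 ≤ Xr := Real.rpow_nonneg (div_nonneg (Nat.cast_nonneg _) hCδ.le) _
  set a : ℕ := max 1 ⌊Xr⌋₊ with ha
  have ha1 : 1 ≤ a := le_max_left _ _
  have haX : Xr < a + 1 := by
    calc Xr < ⌊Xr⌋₊ + 1 := Nat.lt_floor_add_one Xr
      _ ≤ a + 1 := by gcongr; exact_mod_cast le_max_right 1 ⌊Xr⌋₊
  refine ⟨a, ha1, haX, ?_⟩
  -- `R_s(⟨a,a,a⟩) ≤ g`
  have hag : supportRank (matMulTensor K a a a) ≤ g := by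
    rcases Nat.lt_or_ge 0 ⌊Xr⌋₊ with hfl | hfl
    · have ha' : a = ⌊Xr⌋₊ := max_eq_right hfl
      have haXr : (a : ℝ) ≤ Xr := by rw [ha']; exact Nat.floor_le hXr0
      have ha0 : (0 : ℝ) ≤ a := Nat.cast_nonneg _
      have h3 : Xr ^ (omegaS K + δ) = (g : ℝ) / Cδ := by
        rw [hXr]; exact Real.rpow_inv_rpow (div_nonneg (Nat.cast_nonneg _) hCδ.le) hωδ.ne'
      have h4 : (supportRank (matMulTensor K a a a) : ℝ) ≤ g := by
        calc (supportRank (matMulTensor K a a a) : ℝ) ≤ Cδ * (a : ℝ) ^ (omegaS K + δ) :=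
              hCδb a ha1
          _ ≤ Cδ * Xr ^ (omegaS K + δ) :=
              mul_le_mul_of_nonneg_left (Real.rpow_le_rpow ha0 haXr hωδ.le) hCδ.le
          _ = g := by rw [h3]; field_simp
      exact_mod_cast h4
    · have ha' : a = 1 := by simp [ha, Nat.le_zero.1 hfl]
      rw [ha']
      calc supportRank (matMulTensor K 1 1 1) ≤ tensorRank (matMulTensor K 1 1 1) :=
            supportRank_le_tensorRank _
        _ ≤ 1 * 1 * 1 := tensorRank_matMulTensor_le K 1 1 1
        _ ≤ g := by simpa using hg1
  obtain ⟨V, hV, hVr⟩ := exists_sameSupport_tensorRank_eq (matMulTensor K a a a)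
  have hVg : tensorRank V ≤ g := hVr ▸ hag
  -- the format `⟨a Q^t⟩` versus `V ⊗ W_t`
  let φ : Fin (Q ^ t) × Fin (Q ^ t) → (Fin t → Fin Q × Fin Q) := fun u i =>
    ((finFunctionFinEquiv.symm u.1) i, (finFunctionFinEquiv.symm u.2) i)
  let ψ : Fin (a * Q ^ t) × Fin (a * Q ^ t) → (Fin a × Fin a) × (Fin t → Fin Q × Fin Q) :=
    fun A => (((doubleIndexEquiv a a (Q ^ t) (Q ^ t)).symm A).1,
      φ ((doubleIndexEquiv a a (Q ^ t) (Q ^ t)).symm A).2)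
  have hsupp : SameSupport (matMulTensor K (a * Q ^ t) (a * Q ^ t) (a * Q ^ t))
      (fun A B C => kroneckerTensor V Wt (ψ A) (ψ B) (ψ C)) := by
    intro A B C
    have e1 := kroneckerTensor_matMulTensor (K := K) a a a (Q ^ t) (Q ^ t) (Q ^ t)
      ((doubleIndexEquiv a a (Q ^ t) (Q ^ t)).symm A)
      ((doubleIndexEquiv a a (Q ^ t) (Q ^ t)).symm B)
      ((doubleIndexEquiv a a (Q ^ t) (Q ^ t)).symm C)
    simp only [Equiv.apply_symm_apply] at e1
    rw [← e1, kroneckerTensor_apply, matMulTensor_pow_eq_kroneckerPow_comp K Q Q Q t]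
    simp only [ψ, φ, kroneckerTensor_apply, mul_ne_zero_iff]
    exact and_congr (hV _ _ _) (hWt _ _ _)
  have hup : supportRank (matMulTensor K (a * Q ^ t) (a * Q ^ t) (a * Q ^ t)) ≤
      tensorRank D ^ t :=
    calc supportRank (matMulTensor K (a * Q ^ t) (a * Q ^ t) (a * Q ^ t))
        ≤ tensorRank (fun A B C => kroneckerTensor V Wt (ψ A) (ψ B) (ψ C)) :=
          supportRank_le_of_sameSupport hsupp le_rfl
      _ ≤ tensorRank (kroneckerTensor V Wt) := tensorRank_precomp_le _ ψ ψ ψ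
      _ ≤ tensorRank (kroneckerTensor (unitTensor K g) Wt) :=
          tensorRank_kroneckerTensor_le_multiple V Wt hVg
      _ ≤ tensorRank D ^ t := hrank
  have hlow := rpow_omegaS_div_three_le_supportRank (K := K) (a * Q ^ t) (a * Q ^ t) (a * Q ^ t)
  have h0 : (0 : ℝ) ≤ (a : ℝ) * (Q : ℝ) ^ t := by positivity
  have hcast : (((a * Q ^ t) * (a * Q ^ t) * (a * Q ^ t) : ℕ) : ℝ) ^ (omegaS K / 3) =
      ((a : ℝ) * (Q : ℝ) ^ t) ^ omegaS K := by
    rw [show (((a * Q ^ t) * (a * Q ^ t) * (a * Q ^ t) : ℕ) : ℝ) =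
        ((a : ℝ) * (Q : ℝ) ^ t) ^ (3 : ℕ) by push_cast; ring]
    rw [← Real.rpow_natCast, ← Real.rpow_mul h0]
    congr 1; push_cast; ring
  calc ((a : ℝ) * (Q : ℝ) ^ t) ^ omegaS K
      = (((a * Q ^ t) * (a * Q ^ t) * (a * Q ^ t) : ℕ) : ℝ) ^ (omegaS K / 3) := hcast.symm
    _ ≤ supportRank (matMulTensor K (a * Q ^ t) (a * Q ^ t) (a * Q ^ t)) := hlow
    _ ≤ ((tensorRank D ^ t : ℕ) : ℝ) := by exact_mod_cast hup
    _ = (tensorRank D : ℝ) ^ t := by push_cast; ring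

/-- **s-rank asymptotic sum inequality (cube case, `δ`-form).** If `D` has the support of
`⟨P⟩ ⊗ ⟨Q,Q,Q⟩` (`P ≥ 1`, `Q ≥ 2`), then `P^{ω_s/(ω_s+δ)} · Q^{ω_s} ≤ R(D)` for every `δ > 0`
(logarithms of `supportSum_level`, `t → ∞`: the losses `(t+1)^P`, `C_δ`, `2` are sub-exponential in
`t`). [cite: CohnUmans2013, §5 eq. (s-rank-asi)] -/
theorem rpow_mul_rpow_omegaS_le_tensorRank {P Q : ℕ} (hP : 1 ≤ P) (hQ : 2 ≤ Q)
    (D : Fin P × (Fin Q × Fin Q) → Fin P × (Fin Q × Fin Q) → Fin P × (Fin Q × Fin Q) → K)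
    (hD : SameSupport (kroneckerTensor (unitTensor K P) (matMulTensor K Q Q Q)) D)
    {δ : ℝ} (hδ : 0 < δ) :
    (P : ℝ) ^ (omegaS K / (omegaS K + δ)) * (Q : ℝ) ^ omegaS K ≤ tensorRank D := by
  have hω2 : 2 ≤ omegaS K := omegaS_two_le K
  have hω0 : 0 < omegaS K := by linarith
  have hωδ : 0 < omegaS K + δ := by linarith
  set θ : ℝ := omegaS K / (omegaS K + δ) with hθ
  have hθ0 : 0 ≤ θ := div_nonneg hω0.le hωδ.le
  have hP0 : (0 : ℝ) < P := by exact_mod_cast hP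
  have hQ0 : (0 : ℝ) < Q := by exact_mod_cast (by omega : 0 < Q)
  obtain ⟨Cδ, hCδ, hCδb⟩ := exists_supportRank_matMulTensor_le_rpow K hδ
  have step := supportSum_level hP hQ D hD hCδ hCδb hωδ
  set R : ℝ := (tensorRank D : ℝ) with hR
  have hR0 : 0 < R := by
    obtain ⟨g, -, -, a, ha1, -, hle⟩ := step 1
    have ha0 : (0 : ℝ) < a := by exact_mod_cast ha1
    have h1 : (0 : ℝ) < ((a : ℝ) * (Q : ℝ) ^ 1) ^ omegaS K := Real.rpow_pos_of_pos (by positivity) _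
    simpa using h1.trans_le hle
  have key : θ * Real.log P + omegaS K * Real.log Q ≤ Real.log R := by
    refine le_of_forall_large_mul_le (c := 2 * (θ * P))
      (c' := θ * P * Real.log 2 + θ * Real.log Cδ + omegaS K * Real.log 2) ⟨1, fun t ht => ?_⟩
    obtain ⟨g, hg1, hcount, a, ha1, haX, hle⟩ := step t
    have hg0 : (0 : ℝ) < g := by exact_mod_cast hg1
    have ha0 : (0 : ℝ) < a := by exact_mod_cast ha1
    have ha1' : (1 : ℝ) ≤ a := by exact_mod_cast ha1
    have ht0 : (0 : ℝ) < t := by exact_mod_cast ht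
    set Xr : ℝ := ((g : ℝ) / Cδ) ^ (omegaS K + δ)⁻¹ with hXr
    have hXpos : 0 < Xr := Real.rpow_pos_of_pos (div_pos hg0 hCδ) _
    have h1 : omegaS K * (Real.log a + t * Real.log Q) ≤ t * Real.log R := by
      have hpos : (0 : ℝ) < (a : ℝ) * (Q : ℝ) ^ t := by positivity
      have hl := Real.log_le_log (Real.rpow_pos_of_pos hpos _) hle
      rwa [Real.log_rpow hpos, Real.log_pow, Real.log_mul ha0.ne' (by positivity),
        Real.log_pow] at hl
    have h2 : Real.log Xr - Real.log 2 ≤ Real.log a := by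
      have hle2 : Xr / 2 ≤ a := by linarith
      have hl := Real.log_le_log (by positivity) hle2
      rwa [Real.log_div hXpos.ne' two_ne_zero] at hl
    have h3 : Real.log Xr = (Real.log g - Real.log Cδ) / (omegaS K + δ) := by
      rw [hXr, Real.log_rpow (div_pos hg0 hCδ), Real.log_div hg0.ne' hCδ.ne']; ring
    have h4 : t * Real.log P - P * Real.log ((t : ℝ) + 1) ≤ Real.log g := by
      have hc : ((P : ℝ) ^ t) ≤ ((t : ℝ) + 1) ^ P * g := by exact_mod_cast hcount
      have hl := Real.log_le_log (by positivity) hc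
      rw [Real.log_pow, Real.log_mul (by positivity) hg0.ne', Real.log_pow] at hl
      linarith
    have h5 : Real.log ((t : ℝ) + 1) ≤ Real.log 2 + 2 * √(t : ℝ) := by
      have ht1 : (t : ℝ) + 1 ≤ 2 * t := by linarith [show (1 : ℝ) ≤ t by exact_mod_cast ht]
      calc Real.log ((t : ℝ) + 1) ≤ Real.log (2 * t) := Real.log_le_log (by positivity) ht1
        _ = Real.log 2 + Real.log t := Real.log_mul two_ne_zero ht0.ne'
        _ ≤ Real.log 2 + 2 * √(t : ℝ) := by linarith [log_le_two_mul_sqrt ht0]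
    have h6 : θ * (t * Real.log P - P * Real.log ((t : ℝ) + 1) - Real.log Cδ)
        - omegaS K * Real.log 2 ≤ omegaS K * Real.log a := by
      have hm : (t * Real.log P - P * Real.log ((t : ℝ) + 1) - Real.log Cδ) / (omegaS K + δ)
          - Real.log 2 ≤ Real.log a := by
        have : (t * Real.log P - P * Real.log ((t : ℝ) + 1) - Real.log Cδ) / (omegaS K + δ)
            ≤ Real.log Xr := by
          rw [h3]; exact div_le_div_of_nonneg_right (by linarith) hωδ.le
        linarith
      have hm' := mul_le_mul_of_nonneg_left hm hω0.le
      have e : omegaS K * ((t * Real.log P - P * Real.log ((t : ℝ) + 1) - Real.log Cδ)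
          / (omegaS K + δ) - Real.log 2) = θ * (t * Real.log P - P * Real.log ((t : ℝ) + 1)
          - Real.log Cδ) - omegaS K * Real.log 2 := by rw [hθ]; ring
      linarith
    have h7 := mul_le_mul_of_nonneg_left h5 (mul_nonneg hθ0 hP0.le)
    nlinarith [h1, h6, h7, mul_nonneg hθ0 hP0.le]
  calc (P : ℝ) ^ θ * (Q : ℝ) ^ omegaS K
      = Real.exp (Real.log P * θ) * Real.exp (Real.log Q * omegaS K) := by
        rw [Real.rpow_def_of_pos hP0, Real.rpow_def_of_pos hQ0]
    _ = Real.exp (θ * Real.log P + omegaS K * Real.log Q) := by rw [← Real.exp_add]; ring_nf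
    _ ≤ Real.exp (Real.log R) := Real.exp_le_exp.2 key
    _ = R := Real.exp_log hR0

/-- **s-rank asymptotic sum inequality (cube case).** If `D` has the support of
`⟨P⟩ ⊗ ⟨Q,Q,Q⟩` with `P ≥ 1` and `Q ≥ 2`, then `P · Q^{ω_s} ≤ R(D)`; equivalently
`P · Q^{ω_s} ≤ R_s(⟨P⟩ ⊗ ⟨Q,Q,Q⟩)` (Cohn–Umans 2013, eq. (s-rank-asi), cube case; `δ → 0` in
`rpow_mul_rpow_omegaS_le_tensorRank`). [cite: CohnUmans2013, §5 eq. (s-rank-asi)] -/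
theorem mul_rpow_omegaS_le_tensorRank {P Q : ℕ} (hP : 1 ≤ P) (hQ : 2 ≤ Q)
    (D : Fin P × (Fin Q × Fin Q) → Fin P × (Fin Q × Fin Q) → Fin P × (Fin Q × Fin Q) → K)
    (hD : SameSupport (kroneckerTensor (unitTensor K P) (matMulTensor K Q Q Q)) D) :
    (P : ℝ) * (Q : ℝ) ^ omegaS K ≤ tensorRank D := by
  have hω2 : 2 ≤ omegaS K := omegaS_two_le K
  have hω0 : 0 < omegaS K := by linarith
  have hP0 : (0 : ℝ) < P := by exact_mod_cast hP
  have hQ0 : (0 : ℝ) < Q := by exact_mod_cast (by omega : 0 < Q)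
  have hlogP : 0 ≤ Real.log P := Real.log_nonneg (by exact_mod_cast hP)
  set R : ℝ := (tensorRank D : ℝ) with hR
  have hR0 : 0 < R := by
    have h := rpow_mul_rpow_omegaS_le_tensorRank hP hQ D hD one_pos
    exact lt_of_lt_of_le (by positivity) h
  have key : Real.log P + omegaS K * Real.log Q ≤ Real.log R := by
    refine le_of_forall_pos_le_add fun η hη => ?_
    have hL1 : 0 < Real.log P + 1 := by linarith
    set δ : ℝ := η / (Real.log P + 1) with hδ
    have hδ0 : 0 < δ := div_pos hη hL1
    have hωδ : 0 < omegaS K + δ := by linarith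
    have h := rpow_mul_rpow_omegaS_le_tensorRank hP hQ D hD hδ0
    have hl := Real.log_le_log (by positivity) h
    rw [Real.log_mul (by positivity) (by positivity), Real.log_rpow hP0, Real.log_rpow hQ0] at hl
    have hsplit : Real.log P = omegaS K / (omegaS K + δ) * Real.log P
        + δ / (omegaS K + δ) * Real.log P := by
      rw [← add_mul, ← add_div, div_self hωδ.ne', one_mul]
    have hsmall : δ / (omegaS K + δ) * Real.log P ≤ η := by
      have h1 : δ / (omegaS K + δ) ≤ δ := div_le_self hδ0.le (by linarith)
      have h2 : δ * Real.log P ≤ η := by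
        rw [hδ, div_mul_eq_mul_div, div_le_iff₀ hL1]; nlinarith
      nlinarith [mul_le_mul_of_nonneg_right h1 hlogP]
    linarith
  calc (P : ℝ) * (Q : ℝ) ^ omegaS K
      = Real.exp (Real.log P) * Real.exp (Real.log Q * omegaS K) := by
        rw [Real.exp_log hP0, Real.rpow_def_of_pos hQ0]
    _ = Real.exp (Real.log P + omegaS K * Real.log Q) := by rw [← Real.exp_add]; ring_nf
    _ ≤ Real.exp (Real.log R) := Real.exp_le_exp.2 key
    _ = R := Real.exp_log hR0

end Summit.MatrixMultiplication.MatrixMultiplication.Theorems.SupportRankDoor
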